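import Summits.CriticalPhenomena.CardyFormulaZ2.Theorems.CardySusyWardParafermionFamiliesToSLESixSCRigidityB

/-!
# Schwarz–Christoffel rigidity on the strip, III: boundary values of `h′/g′` on the bottom line,
# and the symmetry `w ↦ conj w + i`

Helper file for the crux `CardySusyWard.ParafermionFamiliesToSLESix` (stmt-CriticalPhenomena-10814),
line `exact-potential-schwarz-christoffel`, stub `stub_scRigidity`.

* `tendsto_div_regular`, `tendsto_div_bottom` — for bounded holomorphic `g, h` on the strip with
  monotone collinear bottom traces of the same piecewise-constant direction, `g′ ≠ 0`, `|g′|` bounded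
  below near regular points and `m ≤ |w - b|^β |g′|` (`β > -1`) at the breakpoints, the quotient `h′/g′`
  has a non-negative real limit from inside the strip at EVERY point of the bottom line;
* `norm_deriv_le_far_bottom` — `|h′| ≤ 8M` in the lower half-strip far from the breakpoints;
* the symmetry `f ↦ conj ∘ f ∘ (conj · + i)` of the strip, which swaps the two boundary lines
  (`deriv_conjTop`, `differentiableOn_conjTop`, `trace_conjTop`, `lowerBound_conjTop`, …), used in
  part IV to transport the bottom-line results to the top line.
-/

noncomputable section

namespace Summit.CriticalPhenomena.CardyFormulaZ2.Theorems.ParafermionFamiliesToSLESix.SCRigidity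

open Complex Set Filter Metric Topology
open scoped ComplexConjugate Real

/-- **The quotient `h′/g′` at a regular point of the bottom line.**  Bounded holomorphic `g, h` on the
strip with monotone collinear bottom traces of the same piecewise-constant direction `θ₀` (breakpoints
`B₀`), `|g′|` bounded below near the regular point `x ∉ B₀`: then `h′/g′` has a non-negative real limit
at `x` from inside the strip. [folklore] -/
theorem tendsto_div_regular {θ₀ : ℝ → ℝ} {B₀ : Finset ℝ} {g h : ℂ → ℂ} {M : ℝ}
    (hθ : ∀ x y : ℝ, (∀ b ∈ B₀, (x < b ↔ y < b)) → θ₀ x = θ₀ y)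
    (hgd : DifferentiableOn ℂ g {w : ℂ | 0 < w.im ∧ w.im < 1})
    (hgc : ContinuousOn g {w : ℂ | 0 ≤ w.im ∧ w.im ≤ 1})
    (hgM : ∀ w ∈ {w : ℂ | 0 ≤ w.im ∧ w.im ≤ 1}, ‖g w‖ ≤ M)
    (hhd : DifferentiableOn ℂ h {w : ℂ | 0 < w.im ∧ w.im < 1})
    (hhc : ContinuousOn h {w : ℂ | 0 ≤ w.im ∧ w.im ≤ 1})
    (hhM : ∀ w ∈ {w : ℂ | 0 ≤ w.im ∧ w.im ≤ 1}, ‖h w‖ ≤ M)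
    (hgtr : ∀ x y : ℝ, x ≤ y → (∀ b ∈ B₀, (x < b ↔ y < b)) →
      (exp (-(θ₀ x : ℂ) * I) * (g y - g x)).im = 0 ∧ 0 ≤ (exp (-(θ₀ x : ℂ) * I) * (g y - g x)).re)
    (hhtr : ∀ x y : ℝ, x ≤ y → (∀ b ∈ B₀, (x < b ↔ y < b)) →
      (exp (-(θ₀ x : ℂ) * I) * (h y - h x)).im = 0 ∧ 0 ≤ (exp (-(θ₀ x : ℂ) * I) * (h y - h x)).re)
    (hlow : ∀ x : ℝ, x ∉ B₀ → ∃ r > (0 : ℝ), ∃ c > (0 : ℝ),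
      ∀ w ∈ ball (x : ℂ) r ∩ {w : ℂ | 0 < w.im ∧ w.im < 1}, c ≤ ‖deriv g w‖)
    {x : ℝ} (hx : x ∉ B₀) :
    ∃ L : ℝ, 0 ≤ L ∧ Tendsto (fun w => deriv h w / deriv g w)
      (𝓝[{w : ℂ | 0 < w.im ∧ w.im < 1}] (x : ℂ)) (𝓝 (L : ℂ)) := by
  obtain ⟨ε, hε, hεB⟩ : ∃ ε > 0, ball x ε ⊆ (↑B₀ : Set ℝ)ᶜ :=
    Metric.mem_nhds_iff.mp ((B₀.finite_toSet.isClosed.isOpen_compl).mem_nhds hx)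
  obtain ⟨r, hr, c, hc, hlow'⟩ := hlow x hx
  set ρ : ℝ := min (min ε 1) r with hρ
  have hρ0 : 0 < ρ := lt_min (lt_min hε one_pos) hr
  have hρ1 : ρ ≤ 1 := (min_le_left _ _).trans (min_le_right _ _)
  have hρε : ρ ≤ ε := (min_le_left _ _).trans (min_le_left _ _)
  have hρr : ρ ≤ r := min_le_right _ _
  have hseg : ∀ y : ℝ, |y - x| < ρ → ∀ b ∈ B₀, (x < b ↔ y < b) := by
    intro y hy
    rw [abs_lt] at hy
    refine sameSegment_of_mem_Ioo (p := x - ρ) (q := x + ρ) ⟨by linarith, by linarith⟩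
      ⟨by linarith, by linarith⟩ ?_
    intro b hb hbI
    rw [mem_Ioo] at hbI
    have : b ∈ ball x ε := by
      rw [Metric.mem_ball, Real.dist_eq, abs_lt]
      constructor <;> linarith
    exact hεB this hb
  have hg_real : ∀ y : ℝ, |y - x| < ρ → (exp (-(θ₀ x : ℂ) * I) * (g y - g x)).im = 0 :=
    fun y hy => trace_im_eq_zero hθ hgtr (hseg y hy)
  have hh_real : ∀ y : ℝ, |y - x| < ρ → (exp (-(θ₀ x : ℂ) * I) * (h y - h x)).im = 0 :=
    fun y hy => trace_im_eq_zero hθ hhtr (hseg y hy)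
  have hg_pos : ∀ y : ℝ, x < y → y < x + ρ → 0 ≤ (exp (-(θ₀ x : ℂ) * I) * (g y - g x)).re :=
    fun y h1 h2 => (hgtr x y h1.le (hseg y (by rw [abs_lt]; constructor <;> linarith))).2
  have hh_pos : ∀ y : ℝ, x < y → y < x + ρ → 0 ≤ (exp (-(θ₀ x : ℂ) * I) * (h y - h x)).re :=
    fun y h1 h2 => (hhtr x y h1.le (hseg y (by rw [abs_lt]; constructor <;> linarith))).2
  have hlow'' : ∀ w ∈ ball (x : ℂ) ρ, 0 < w.im → c ≤ ‖deriv g w‖ := by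
    intro w hw hw0
    refine hlow' w ⟨ball_subset_ball hρr hw, hw0, ?_⟩
    rw [mem_ball, dist_eq_norm] at hw
    have := abs_im_le_norm (w - x)
    simp only [sub_im, ofReal_im, sub_zero] at this
    linarith [le_abs_self w.im]
  exact tendsto_div_of_reflections hρ0 hρ1 hc hgd hgc hgM hhd hhc hhM hg_real hh_real hg_pos
    hh_pos hlow''

/-- **The quotient `h′/g′` has non-negative real boundary values along the whole bottom line.**  As in
`tendsto_div_regular`, plus: `g′ ≠ 0` inside, and at each breakpoint `b ∈ B₀` a quantitative
Schwarz–Christoffel lower bound `m ≤ |w - b|^β |g′ w|` with `β > -1`.  At a breakpoint the limit exists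
by `tendsto_of_nonneg_traces_near_breakpoint` (`|h′| ≤ 12M/|w - b|` by
`norm_deriv_le_near_breakpoint`, so `|h′/g′| ≤ (12M/m)|w - b|^{β-1}`). [folklore] -/
theorem tendsto_div_bottom :
    ∀ {θ₀ : ℝ → ℝ} {B₀ : Finset ℝ} {g h : ℂ → ℂ} {M : ℝ},
    (∀ x y : ℝ, (∀ b ∈ B₀, (x < b ↔ y < b)) → θ₀ x = θ₀ y) →
    DifferentiableOn ℂ g {w : ℂ | 0 < w.im ∧ w.im < 1} →
    ContinuousOn g {w : ℂ | 0 ≤ w.im ∧ w.im ≤ 1} →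
    (∀ w ∈ {w : ℂ | 0 ≤ w.im ∧ w.im ≤ 1}, ‖g w‖ ≤ M) →
    DifferentiableOn ℂ h {w : ℂ | 0 < w.im ∧ w.im < 1} →
    ContinuousOn h {w : ℂ | 0 ≤ w.im ∧ w.im ≤ 1} →
    (∀ w ∈ {w : ℂ | 0 ≤ w.im ∧ w.im ≤ 1}, ‖h w‖ ≤ M) →
    (∀ x y : ℝ, x ≤ y → (∀ b ∈ B₀, (x < b ↔ y < b)) →
      (exp (-(θ₀ x : ℂ) * I) * (g y - g x)).im = 0 ∧ 0 ≤ (exp (-(θ₀ x : ℂ) * I) * (g y - g x)).re) →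
    (∀ x y : ℝ, x ≤ y → (∀ b ∈ B₀, (x < b ↔ y < b)) →
      (exp (-(θ₀ x : ℂ) * I) * (h y - h x)).im = 0 ∧ 0 ≤ (exp (-(θ₀ x : ℂ) * I) * (h y - h x)).re) →
    (∀ w ∈ {w : ℂ | 0 < w.im ∧ w.im < 1}, deriv g w ≠ 0) →
    (∀ x : ℝ, x ∉ B₀ → ∃ r > (0 : ℝ), ∃ c > (0 : ℝ),
      ∀ w ∈ ball (x : ℂ) r ∩ {w : ℂ | 0 < w.im ∧ w.im < 1}, c ≤ ‖deriv g w‖) →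
    (∀ b ∈ B₀, ∃ β : ℝ, -1 < β ∧ ∃ m > (0 : ℝ), ∃ r > (0 : ℝ),
      ∀ w ∈ ball (b : ℂ) r ∩ {w : ℂ | 0 < w.im ∧ w.im < 1}, m ≤ ‖w - b‖ ^ β * ‖deriv g w‖) →
    ∀ x : ℝ, ∃ L : ℝ, 0 ≤ L ∧ Tendsto (fun w => deriv h w / deriv g w)
      (𝓝[{w : ℂ | 0 < w.im ∧ w.im < 1}] (x : ℂ)) (𝓝 (L : ℂ)) := by
  intro θ₀ B₀ g h M hθ hgd hgc hgM hhd hhc hhM hgtr hhtr hg' hlow hbk x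
  by_cases hx : x ∈ B₀
  swap
  · exact tendsto_div_regular hθ hgd hgc hgM hhd hhc hhM hgtr hhtr hlow hx
  -- `x` is a breakpoint: isolate it
  obtain ⟨ε, hε, hεB⟩ : ∃ ε > 0, ball x ε ⊆ (↑(B₀.erase x) : Set ℝ)ᶜ :=
    Metric.mem_nhds_iff.mp (((B₀.erase x).finite_toSet.isClosed.isOpen_compl).mem_nhds (by simp))
  obtain ⟨β, hβ, m, hm, r, hr, hmr⟩ := hbk x hx
  set r₁ : ℝ := min (min (ε / 2) (1 / 2)) r with hr₁
  have hr₁0 : 0 < r₁ := lt_min (lt_min (by linarith) (by norm_num)) hr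
  have hr₁ε : 2 * r₁ ≤ ε := by
    have : r₁ ≤ ε / 2 := (min_le_left _ _).trans (min_le_left _ _)
    linarith
  have hr₁h : r₁ ≤ 1 / 2 := (min_le_left _ _).trans (min_le_right _ _)
  have hr₁r : r₁ ≤ r := min_le_right _ _
  have hM0 : 0 ≤ M := (norm_nonneg _).trans (hgM 0 (by simp))
  have hQd : DifferentiableOn ℂ (fun w => deriv h w / deriv g w)
      (ball (x : ℂ) r₁ ∩ {w : ℂ | 0 < w.im ∧ w.im < 1}) :=
    ((hhd.deriv isOpen_strip).div (hgd.deriv isOpen_strip) hg').mono inter_subset_right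
  have hfarB : ∀ b' ∈ B₀, b' ≠ x → ε ≤ |b' - x| := by
    intro b' hb' hbx
    have hfar : b' ∉ ball x ε := fun hb =>
      hεB hb (Finset.mem_coe.mpr (Finset.mem_erase.mpr ⟨hbx, hb'⟩))
    rwa [Metric.mem_ball, Real.dist_eq, not_lt] at hfar
  have hlim : ∀ y : ℝ, y ≠ x → |y - x| < r₁ → ∃ L : ℝ, 0 ≤ L ∧
      Tendsto (fun w => deriv h w / deriv g w) (𝓝[{w : ℂ | 0 < w.im ∧ w.im < 1}] (y : ℂ))
        (𝓝 (L : ℂ)) := by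
    intro y hy hyr
    have hyB : y ∉ B₀ := fun hyB => by
      have := hfarB y hyB hy
      linarith
    exact tendsto_div_regular hθ hgd hgc hgM hhd hhc hhM hgtr hhtr hlow hyB
  have hreal : ∀ y : ℝ, y ≠ x → |y - x| < r₁ → ∃ θ : ℝ, ∀ z : ℝ, |z - y| < |y - x| →
      (exp (-(θ : ℂ) * I) * (h z - h y)).im = 0 := by
    intro y hy hyr
    refine ⟨θ₀ y, fun z hz => trace_im_eq_zero hθ hhtr ?_⟩
    have ha : 0 < |y - x| := abs_pos.mpr (sub_ne_zero.mpr hy)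
    refine sameSegment_of_mem_Ioo (p := y - |y - x|) (q := y + |y - x|) ⟨by linarith, by linarith⟩
      ?_ ?_
    · rw [abs_lt] at hz
      exact ⟨by linarith, by linarith⟩
    · intro b' hb' hbI
      rw [mem_Ioo] at hbI
      have h1 : |b' - y| < |y - x| := abs_sub_lt_iff.mpr ⟨by linarith, by linarith⟩
      by_cases hbx : b' = x
      · rw [hbx, abs_sub_comm] at h1
        exact lt_irrefl _ h1
      · have h2 := hfarB b' hb' hbx
        have h3 : |b' - x| ≤ |b' - y| + |y - x| := abs_sub_le _ _ _
        linarith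
  have hK : ∀ w ∈ ball (x : ℂ) r₁ ∩ {w : ℂ | 0 < w.im ∧ w.im < 1},
      ‖deriv h w / deriv g w‖ ≤ 12 * M / m * ‖w - x‖ ^ (β - 1) := by
    rintro w ⟨hw, hwS⟩
    have h1 := norm_deriv_le_near_breakpoint hr₁h hM0 hhd hhc hhM hreal hw hwS.1
    have h2 := hmr w ⟨ball_subset_ball hr₁r hw, hwS⟩
    have hne : ‖w - (x : ℂ)‖ ≠ 0 := by
      rw [norm_ne_zero_iff, sub_ne_zero]
      intro hwx
      have := hwS.1
      rw [hwx, ofReal_im] at this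
      exact lt_irrefl _ this
    have hg0 : 0 < ‖deriv g w‖ := norm_pos_iff.mpr (hg' w hwS)
    rw [norm_div]
    have hB : 1 / ‖deriv g w‖ ≤ ‖w - (x : ℂ)‖ ^ β / m := by
      rw [div_le_div_iff₀ hg0 hm, one_mul]
      exact h2
    calc ‖deriv h w‖ / ‖deriv g w‖ = ‖deriv h w‖ * (1 / ‖deriv g w‖) := by rw [mul_one_div]
      _ ≤ (12 * M / ‖w - x‖) * (‖w - (x : ℂ)‖ ^ β / m) :=
          mul_le_mul h1 hB (by positivity) (div_nonneg (by linarith) (norm_nonneg _))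
      _ = 12 * M / m * ‖w - (x : ℂ)‖ ^ (β - 1) := by
          rw [Real.rpow_sub_one hne]
          ring
  exact tendsto_of_nonneg_traces_near_breakpoint hr₁0 (by linarith) hβ hQd hlim hK

/-- **Far-field derivative bound in the lower half of the strip.**  A bounded holomorphic `f` with real
bottom traces along the piecewise-constant direction `θ₀` has `‖f′ w‖ ≤ 8M` at every `w` of the strip
with `im w ≤ 1/2` whose real part is at distance `≥ 1` from the breakpoints. [folklore] -/
theorem norm_deriv_le_far_bottom {θ₀ : ℝ → ℝ} {B₀ : Finset ℝ} {f : ℂ → ℂ} {M : ℝ}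
    (hθ : ∀ x y : ℝ, (∀ b ∈ B₀, (x < b ↔ y < b)) → θ₀ x = θ₀ y)
    (hd : DifferentiableOn ℂ f {w : ℂ | 0 < w.im ∧ w.im < 1})
    (hc : ContinuousOn f {w : ℂ | 0 ≤ w.im ∧ w.im ≤ 1})
    (hM : ∀ w ∈ {w : ℂ | 0 ≤ w.im ∧ w.im ≤ 1}, ‖f w‖ ≤ M)
    (htr : ∀ x y : ℝ, x ≤ y → (∀ b ∈ B₀, (x < b ↔ y < b)) →
      (exp (-(θ₀ x : ℂ) * I) * (f y - f x)).im = 0 ∧ 0 ≤ (exp (-(θ₀ x : ℂ) * I) * (f y - f x)).re)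
    {w : ℂ} (hw0 : 0 < w.im) (hw : w.im ≤ 1 / 2) (hfar : ∀ b ∈ B₀, 1 ≤ |w.re - b|) :
    ‖deriv f w‖ ≤ 8 * M := by
  have hreal : ∀ y : ℝ, |y - w.re| < 1 → (exp (-(θ₀ w.re : ℂ) * I) * (f y - f w.re)).im = 0 := by
    intro y hy
    refine trace_im_eq_zero hθ htr ?_
    rw [abs_lt] at hy
    refine sameSegment_of_mem_Ioo (p := w.re - 1) (q := w.re + 1) ⟨by linarith, by linarith⟩
      ⟨by linarith, by linarith⟩ ?_
    intro b hb hbI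
    rw [mem_Ioo] at hbI
    have := hfar b hb
    have : |w.re - b| < 1 := abs_sub_lt_iff.mpr ⟨by linarith, by linarith⟩
    linarith
  have hdist : dist w (w.re : ℂ) ≤ 1 / 2 := by
    have hwre : w - (w.re : ℂ) = (w.im : ℂ) * I := Complex.ext (by simp) (by simp)
    rw [dist_eq_norm, hwre, norm_mul, norm_real, norm_I, mul_one, Real.norm_eq_abs, abs_of_pos hw0]
    exact hw
  exact norm_deriv_le_far hd hc hM hreal hdist hw0

/-! ### The symmetry `w ↦ conj w + i` of the strip (swaps the two boundary lines) -/

/-- `conj w + i` lies in the open strip when `w` does. [folklore] -/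
theorem conjTop_mem {w : ℂ} (hw : w ∈ {w : ℂ | 0 < w.im ∧ w.im < 1}) :
    conj w + I ∈ {w : ℂ | 0 < w.im ∧ w.im < 1} := by
  simp only [mem_setOf_eq, add_im, conj_im, I_im] at hw ⊢
  constructor <;> linarith [hw.1, hw.2]

/-- `conj w + i` lies in the closed strip when `w` does. [folklore] -/
theorem conjTop_mem_closed {w : ℂ} (hw : w ∈ {w : ℂ | 0 ≤ w.im ∧ w.im ≤ 1}) :
    conj w + I ∈ {w : ℂ | 0 ≤ w.im ∧ w.im ≤ 1} := by
  simp only [mem_setOf_eq, add_im, conj_im, I_im] at hw ⊢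
  constructor <;> linarith [hw.1, hw.2]

/-- `w ↦ conj w + i` is an involution. [folklore] -/
theorem conjTop_conjTop (w : ℂ) : conj (conj w + I) + I = w := by
  rw [map_add, conj_conj, conj_I, neg_add_cancel_right]

/-- Derivative of `w ↦ conj (f (conj w + i))`. [folklore] -/
theorem deriv_conjTop (f : ℂ → ℂ) (w : ℂ) :
    deriv (fun w => conj (f (conj w + I))) w = conj (deriv f (conj w + I)) := by
  have h1 : (fun w => conj (f (conj w + I))) = conj ∘ (fun z => f (z + I)) ∘ conj := rfl
  rw [h1, deriv_conj_conj]
  simp only [Function.comp_apply, deriv_comp_add_const]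

/-- `w ↦ conj (f (conj w + i))` is holomorphic on the strip when `f` is. [folklore] -/
theorem differentiableOn_conjTop {f : ℂ → ℂ}
    (hd : DifferentiableOn ℂ f {w : ℂ | 0 < w.im ∧ w.im < 1}) :
    DifferentiableOn ℂ (fun w => conj (f (conj w + I))) {w : ℂ | 0 < w.im ∧ w.im < 1} := by
  intro w hw
  have h1 : DifferentiableAt ℂ (fun z => f (z + I)) (conj w) :=
    (hd.differentiableAt (isOpen_strip.mem_nhds (conjTop_mem hw))).comp (conj w)
      (differentiableAt_id.add_const I)
  have h2 := h1.conj_conj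
  rw [conj_conj] at h2
  exact h2.differentiableWithinAt

/-- `w ↦ conj (f (conj w + i))` is continuous on the closed strip when `f` is. [folklore] -/
theorem continuousOn_conjTop {f : ℂ → ℂ} (hc : ContinuousOn f {w : ℂ | 0 ≤ w.im ∧ w.im ≤ 1}) :
    ContinuousOn (fun w => conj (f (conj w + I))) {w : ℂ | 0 ≤ w.im ∧ w.im ≤ 1} :=
  continuous_conj.comp_continuousOn
    (hc.comp (continuous_conj.add continuous_const).continuousOn fun _ hw => conjTop_mem_closed hw)

/-- The bound transfers to `w ↦ conj (f (conj w + i))`. [folklore] -/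
theorem norm_conjTop_le {f : ℂ → ℂ} {M : ℝ} (hM : ∀ w ∈ {w : ℂ | 0 ≤ w.im ∧ w.im ≤ 1}, ‖f w‖ ≤ M) :
    ∀ w ∈ {w : ℂ | 0 ≤ w.im ∧ w.im ≤ 1}, ‖conj (f (conj w + I))‖ ≤ M := fun w hw => by
  rw [norm_conj]
  exact hM _ (conjTop_mem_closed hw)

/-- The top trace of `f` (direction `θ₁`) is the bottom trace of `w ↦ conj (f (conj w + i))`
(direction `-θ₁`). [folklore] -/
theorem trace_conjTop {θ₁ : ℝ → ℝ} {B₁ : Finset ℝ} {f : ℂ → ℂ}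
    (htr : ∀ x y : ℝ, x ≤ y → (∀ b ∈ B₁, (x < b ↔ y < b)) →
      (exp (-(θ₁ x : ℂ) * I) * (f (y + I) - f (x + I))).im = 0 ∧
      0 ≤ (exp (-(θ₁ x : ℂ) * I) * (f (y + I) - f (x + I))).re) :
    ∀ x y : ℝ, x ≤ y → (∀ b ∈ B₁, (x < b ↔ y < b)) →
      (exp (-((-θ₁ x : ℝ) : ℂ) * I) *
        (conj (f (conj (y : ℂ) + I)) - conj (f (conj (x : ℂ) + I)))).im = 0 ∧
      0 ≤ (exp (-((-θ₁ x : ℝ) : ℂ) * I) *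
        (conj (f (conj (y : ℂ) + I)) - conj (f (conj (x : ℂ) + I)))).re := by
  intro x y hxy hseg
  obtain ⟨h1, h2⟩ := htr x y hxy hseg
  have key : exp (-((-θ₁ x : ℝ) : ℂ) * I) * (conj (f (conj (y : ℂ) + I)) - conj (f (conj (x : ℂ) + I))) =
      conj (exp (-(θ₁ x : ℂ) * I) * (f (y + I) - f (x + I))) := by
    rw [map_mul, map_sub, ← exp_conj, map_mul, map_neg, conj_ofReal, conj_ofReal, conj_ofReal, conj_I]
    push_cast
    ring_nf
  rw [key, conj_im, conj_re, h1, neg_zero]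
  exact ⟨rfl, h2⟩

/-- The lower bound on `|g′|` near regular top points becomes one near regular bottom points for
`w ↦ conj (g (conj w + i))`. [folklore] -/
theorem lowerBound_conjTop {g : ℂ → ℂ} {B₁ : Finset ℝ}
    (hlow : ∀ x : ℝ, x ∉ B₁ → ∃ r > (0 : ℝ), ∃ c > (0 : ℝ),
      ∀ w ∈ ball ((x : ℂ) + I) r ∩ {w : ℂ | 0 < w.im ∧ w.im < 1}, c ≤ ‖deriv g w‖) :
    ∀ x : ℝ, x ∉ B₁ → ∃ r > (0 : ℝ), ∃ c > (0 : ℝ),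
      ∀ w ∈ ball (x : ℂ) r ∩ {w : ℂ | 0 < w.im ∧ w.im < 1},
        c ≤ ‖deriv (fun w => conj (g (conj w + I))) w‖ := by
  intro x hx
  obtain ⟨r, hr, c, hc, h⟩ := hlow x hx
  refine ⟨r, hr, c, hc, fun w hw => ?_⟩
  rw [deriv_conjTop, norm_conj]
  refine h _ ⟨?_, conjTop_mem hw.2⟩
  have : dist (conj w + I) ((x : ℂ) + I) = dist w x := by
    rw [dist_add_right, ← dist_conj_conj (conj w), conj_conj, conj_ofReal]
  rw [mem_ball, this]
  exact hw.1

end Summit.CriticalPhenomena.CardyFormulaZ2.Theorems.ParafermionFamiliesToSLESix.SCRigidity
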